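import Summits.Langlands.Langlands.Theses.RepeatedRootSocle
import Summits.Langlands.Langlands.Theorems.PhantomRMYoshidaPhantomRMJunctionOfR
import HarnessLib

/-!
# Birth skeleton (BC3) for crux stmt-Langlands-18146 `RepeatedRootSocle.SectorComplementR` — line `birth`, rev 1

Registrar: planner-skel-stmt-Langlands-18146-0 (skeleton-register one-shot, route re-audit bin HONEST),
2026-08-17.  Route `route-Langlands-RepeatedRootSocle` (rev 5; deciding theorem
`closes : PadicLimitUnrefinedR → LimitClassicalUnrefinedR → SectorComplementR → Langlands`, native OK).

  `SectorComplementR := UnrefinedWeightTwoLiftingR → _root_.Langlands`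

is the route's D-0027 JUNCTION over the REPAIRED target (multiplier `ε`, homological convention): "the rest
of the summit" — every `n ≠ 4`, every `F ≠ ℚ`, direction (A), local–global compatibility at every finite
place, the non-vacuity conjunct `Nonempty (ReciprocityData F)`, and all of (B) outside irreducible symplectic
weight-2 `P`-ordinary `ρ` over `ℚ` congruent to an automorphic `ρ₀`.  It is an OPEN PROBLEM by construction
(rank 9, never staffed from this route; `Langlands → SectorComplementR` is `fun h _ => h`, the converse is the
sector theorem).  It supersedes the rev-≤4 junction `SectorComplement`, which is `↔ Langlands` because its
sector was vacuous (`Theorems/SectorComplement/Negative/RepeatedRootSocleVacuity.lean`,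
`sectorComplement_iff_langlands`); the repaired sector is not vacuous, so only `S → C` is trivial here.

## The honest decomposition: by-name leaves R ∧ JS (2.2) ∧ JS (2.3), X inert

After the 2026-08-16 re-type of the summit (`∀ F, Nonempty (ReciprocityData F) ∧ ∀ 𝓡 n hcpt, (A) ∧ (B)`)
the open content of every sector-complement junction of this summit lives in EXISTING items, and the
tree certifies the seam (landed, sorry-free, axioms `propext`/`Classical.choice`/`Quot.sound`):
`PhantomRMYoshidaJunctionOfR.langlands_of_reciprocityUpToIrreducibilityR_text_of_JS : JS (2.2) → JS (2.3) → R → Langlands`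
(`Theorems/PhantomRMYoshidaPhantomRMJunctionOfR.lean`; for each `𝓡`, clause (B) is R's, clause (A)'s avatar is
R's made irreducible by the landed isobaric bootstrap `IrreducibleOffSector.isIrreducible_of_reciprocityUpToIrreducibility`
(p103935), unique up to conjugacy by Flath + Chebotarev–Brauer–Nesbitt + `FramedRep.exists_eq_conj_of_equiv`).
Exactly as certified for the sibling junctions stmt-Langlands-13643 (`PhantomRMYoshida.PhantomRMJunction`),
stmt-Langlands-18056 (`ExteriorSquareAscent.RestOfReciprocity`, line `birth` rev 3) and stmt-Langlands-18275
(`EisensteinGelfandKirillov.SectorComplement`), the stubs are therefore: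

* `stub_reciprocityUpToIrreducibilityR` — VERBATIM the text of item **stmt-Langlands-17925**
  `IrreducibilityBySelfDuality.ReciprocityUpToIrreducibilityR` (reciprocity up to irreducibility for EVERY
  pinned reciprocity datum, with the non-vacuity conjunct; OPEN PROBLEM — the summit minus irreducibility and
  uniqueness-up-to-conjugacy in clause (A); own crux chain `Cruxes/ReciprocityUpToIrreducibility` with
  registered stubs; written out because the decl lives in another route's Theses module).  THE ROUTE'S SECTOR
  X = `UnrefinedWeightTwoLiftingR` IS ONE CELL OF THIS STUB'S CLAUSE (B) (n = 4, F = ℚ, irreducible symplectic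
  weight-2 `P`-ordinary `ρ`, residually enormous, congruent a.e. to an automorphic `ρ₀`; a.e. Satake form only).
* `stub_pairLBoundaryJS` — `AnalyticDescent.PairLBoundaryJS` = item **stmt-Langlands-13622** BY NAME (shared
  decl of 7 routes; Arthur–Clozel Ch. 3 §2 (2.2) = Jacquet–Shalika 1981 + Shahidi: non-vanishing of the partial
  Rankin–Selberg product on Re s = 1 off the X-condition; a theorem in print; crux chain `Cruxes/PairLBoundaryJS`).
* `stub_pairLPoleJS` — `AnalyticDescent.PairLPoleJS` = item **stmt-Langlands-19093** BY NAME (shared decl of 7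
  routes; Arthur–Clozel (2.3) = Jacquet–Shalika II Prop. 3.6: the simple pole in the X-condition; a theorem in print).

`SectorComplementR_of` (kernel-checked, no `sorry`; hypotheses BY STUB NAME through `_Goal.stub_* := type_of% @stub_*`,
the device of `Cruxes/RestOfReciprocity/Lines/birth.lean` rev 3 that `ledger skeleton check` admits): discard X and
apply the seam.  X is visibly unused (`intro _hX`): that is the finding, not an oversight — X contributes
a.e.-Satake automorphy of one family of rank-4 representations over `ℚ`, which R's clause (B) already demands with
full local–global compatibility, and X cannot shrink R, JS (2.2) or JS (2.3) (`¬C ↔ X ∧ ¬Langlands`).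
`ledger skeleton check … --crux stmt-Langlands-18146`: OK — `SectorComplementR_of` concludes the crux, closed=True,
stubs registered: stub_reciprocityUpToIrreducibilityR, stub_pairLBoundaryJS, stub_pairLPoleJS.

Outcome this skeleton supports: `blocked-on: stmt-Langlands-17925` (then 13622 / 19093).  No stub is delegable
to a stub-worker: each is an open item with its own seats.  When all three close,
`SectorComplementR_of R_holds PairLBoundaryJS_holds PairLPoleJS_holds` lands the crux in three lines.

Audit of this file (`lean check --json`, farm, 2026-08-17T13:4xZ): rc 0, errors [], sorries 3 = the three
`stub_*` (declaration lines of `stub_reciprocityUpToIrreducibilityR`, `stub_pairLBoundaryJS`, `stub_pairLPoleJS`;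
zero `sorry` elsewhere), `#print axioms SectorComplementR_of` = [propext, Classical.choice, Quot.sound]; H21 audit:
`SectorComplementR_of` = proof.conditional with target `…Theses.RepeatedRootSocle.SectorComplementR` (the crux BY
NAME) under exactly the three `_Goal.stub_*` hypotheses, `stub_pairLBoundaryJS` / `stub_pairLPoleJS` = proof-of-item
of `AnalyticDescent.PairLBoundaryJS` / `.PairLPoleJS` (not closed: sorryAx), `sectorComplementR_iff` = support (closed).
BC3 probes (registrar, 2026-08-17; files `bc/probeA_*.lean`, `bc/probeB_*.lean` in the registrar's folder; one
`example` per tactic so that a heartbeat time-out cannot mask an alternative; `maxHeartbeats 400000` each).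
Battery A imports ONLY `Summits.Langlands.Langlands.Statement` + the crux-def modules `Theses.RepeatedRootSocle` /
`Theses.AnalyticDescent`: for each stub T, `T → SectorComplementR` by `exact?`, `simpa [SectorComplementR]`,
`(unfold SectorComplementR; simpa)`, `aesop`, `(intro h hX; exact?)` and `T → Langlands` by `exact?`, `simpa`,
`aesop`, `(intro h; exact?)` ALL FAIL — 9/9 per stub, 27/27 in total (exact?: "could not close the goal";
simpa: "assumption failed"; aesop: "failed to prove the goal after exhaustive search").  Battery B additionally
imports the seam module `Theorems.PhantomRMYoshidaPhantomRMJunctionOfR` (everything this file sees except its own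
sorried stubs): `T → C` by `exact?` / `(intro h hX; exact?)` / `aesop` and `T → S` by `exact?` / `(intro h; exact?)`
ALL FAIL — 5/5 per stub, 15/15.  No stub is cheaply the crux or the summit.  Informational converses `S → T`:
cheap only for T = R and only in battery B (`exact?` finds
`PhantomRMYoshidaJunctionOfR.reciprocityUpToIrreducibilityR_text_of_langlands`: R is a consequence of the summit,
used toward it through the seam); `S → PairLBoundaryJS`, `S → PairLPoleJS` fail in both batteries.

Disproof used: none exists for stmt-Langlands-18146 (`ledger crux ls`: no workfiles before this one; no
`Theorems/SectorComplementR/Negative/`).  The legacy crux's `Cruxes/SectorComplement/Disproof.lean` and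
`RepeatedRootSocleVacuity.lean` concern the rev-≤4 multiplier-`ε⁻¹` texts only; no `_false_without_H` bears on
R / JS.  Negatives index (`ledger negatives --problem Langlands`, 4 entries: 16951, 16822, 17212, 3797): none of
the shape of a stub (17212 `RankinSelbergPoleCount` is a pole-COUNT equality for one π, not JS (2.3)).

References: K. Buzzard, T. Gee, LMS LNS 414 (2014), Conj. 3.2.1–3.2.2 [BuzzardGeeLMS2014]; J.-M. Fontaine,
B. Mazur (1995), Conj. 1 [FontaineMazurGeometric1995]; J. Arthur, L. Clozel, Ann. Math. Stud. 120, Ch. 3 §2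
(2.2)–(2.3) [ArthurClozelAMS120]; H. Jacquet, J. Shalika, Amer. J. Math. 103 (1981) I §5, II Prop. 3.6 /
Thm. 4.4 [JacquetShalikaAJM1981II]; M. Harris, R. Taylor, Ann. Math. Stud. 151 (2001), Thm. A
[HarrisTaylorAMS2001]; F. Calegari, "Reciprocity in the Langlands program since Fermat's Last Theorem" (2023)
[Calegari2023]; G. Boxer, F. Calegari, T. Gee, V. Pilloni, arXiv:2502.20645 (2025), Thm. 1.1
[BoxerCalegariGeePilloni2025] (the sector).
-/

noncomputable section

set_option linter.dupNamespace false -- project-wide option; `Summit.Langlands.Langlands` is the mandated namespace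

open scoped NumberField
open Filter IsDedekindDomain
open Literature.NumberTheory.Automorphic Literature.NumberTheory.GaloisRepresentations
open Summit.Langlands
open Summit.Langlands.Langlands.Theses.RepeatedRootSocle (SectorComplementR UnrefinedWeightTwoLiftingR)

namespace Summit.Langlands.Langlands.Cruxes.SectorComplementR.Birth

/-! ## 0. The crux, by name -/

/-- The crux IS `X → Langlands`, definitionally (X = the repaired target `UnrefinedWeightTwoLiftingR`).
[folklore] -/
theorem sectorComplementR_iff :
    SectorComplementR ↔ (UnrefinedWeightTwoLiftingR → _root_.Langlands) :=
  Iff.rfl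

/-- For the record (converse direction, informational `S → C`): the summit gives the crux outright — an
`example`, so that no declaration of this file concludes the crux except the composition. -/
example (h : _root_.Langlands) : SectorComplementR :=
  fun _ => h

/-! ## 1. The three stubs (the ONLY sorries of this file) — each an existing OPEN item -/

/-- **stub R — reciprocity up to irreducibility for every pinned reciprocity datum** = the text of item
stmt-Langlands-17925 `IrreducibilityBySelfDuality.ReciprocityUpToIrreducibilityR`, VERBATIM: for every number
field `F`, (i) reciprocity data exist (`Nonempty (ReciprocityData F)`: a local Langlands datum at every
completion pinned to THE canonical Artin maps — Harris–Taylor 2001 Thm. A / Henniart 2000 + local class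
field theory), and (ii) for EVERY datum `Rec`, every `n ≥ 1`, `hcpt`: (A') every L-algebraic cuspidal `π` of
`GL_n(𝔸_F)` has, for all `ℓ, ι`, SOME geometric `ρ` corresponding to it at every finite place (no
irreducibility, no uniqueness), and (B) every irreducible geometric `ρ` corresponds to some L-algebraic
cuspidal `π`.  OPEN PROBLEM (the summit minus irreducibility/uniqueness in (A)); the route's sector
`UnrefinedWeightTwoLiftingR` is one cell of clause (B) here (n = 4, F = ℚ).  Size: open-problem; never
delegated — it is item stmt-Langlands-17925 with its own crux chain.
[cite: BuzzardGeeLMS2014, Conj. 3.2.1 and Conj. 3.2.2] [cite: FontaineMazurGeometric1995, Conj. 1]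
[cite: HarrisTaylorAMS2001, Thm. A] -/
theorem stub_reciprocityUpToIrreducibilityR : ∀ (F : Type) [Field F] [NumberField F], Nonempty (ReciprocityData F) ∧ ∀ (Rec : ReciprocityData F) (n : ℕ), 0 < n → ∀ hcpt : Literature.NumberTheory.Automorphic.isCompact_glFiniteIntegralLevel n F, (∀ π : Literature.NumberTheory.Automorphic.CuspidalAutomorphicRepData n F hcpt, π.1.IsLAlgebraic → ∀ (ℓ : ℕ) [Fact ℓ.Prime] (ι : PadicAlgCl ℓ ≃+* ℂ), ∃ ρ : Literature.NumberTheory.GaloisRepresentations.FramedGaloisRep F (PadicAlgCl ℓ) n, IsGeometricFramed Rec ρ ∧ Corresponds Rec ι π.1 ρ) ∧ GaloisToAutomorphic n Rec hcpt := by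
  sorry

/-- **stub JS (2.2) — Jacquet–Shalika / Arthur–Clozel Ch. 3 §2 (2.2) for cuspidal Borel–Jacquet data**,
BY NAME: `AnalyticDescent.PairLBoundaryJS` = item stmt-Langlands-13622 (shared decl of seven routes): off
the X-condition, with unitary central characters a.e., the partial Rankin–Selberg product `L^S(s, α × β)`
has a finite NON-ZERO limit at every `s₀` on `Re s = 1` from `Re s > 1`.  A theorem in print (JS 1981 I §5
+ Shahidi 1981); size XL (archimedean / `L²` leaves; crux chain `Cruxes/PairLBoundaryJS`).
[cite: JacquetShalikaAJM1981II, Thm. 4.4] [cite: ArthurClozelAMS120, Ch. 3 §2 (2.2)] -/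
theorem stub_pairLBoundaryJS : Summit.Langlands.Langlands.Theses.AnalyticDescent.PairLBoundaryJS := by
  sorry

/-- **stub JS (2.3) — Jacquet–Shalika II Prop. 3.6 / Arthur–Clozel Ch. 3 §2 (2.3)**, BY NAME:
`AnalyticDescent.PairLPoleJS` = item stmt-Langlands-19093 (shared decl of seven routes): in the
X-condition (`q_w^{1-s₀}·α_w = β_w⁻¹` a.e.) the partial Rankin–Selberg product has a SIMPLE POLE at `s₀`
(`(s - s₀)·L^S(s, α × β)` tends to a non-zero limit).  A theorem in print; size XL.
[cite: JacquetShalikaAJM1981II, Prop. 3.6] [cite: ArthurClozelAMS120, Ch. 3 §2 (2.3)] -/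
theorem stub_pairLPoleJS : Summit.Langlands.Langlands.Theses.AnalyticDescent.PairLPoleJS := by
  sorry

/-! ## 2. The stub statements as named propositions (hypotheses of the composition, admissible by stub name)

Each `_Goal.stub_x` is `type_of% @stub_x`: literally the stub's statement, no text duplicated, no `sorry` inherited
(same device as `Cruxes/RestOfReciprocity/Lines/birth.lean` rev 3). -/

namespace _Goal

/-- The statement of `stub_reciprocityUpToIrreducibilityR` (literally its type). [folklore] -/
def stub_reciprocityUpToIrreducibilityR : Prop :=
  type_of% @Summit.Langlands.Langlands.Cruxes.SectorComplementR.Birth.stub_reciprocityUpToIrreducibilityR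

/-- The statement of `stub_pairLBoundaryJS` (literally its type). [folklore] -/
def stub_pairLBoundaryJS : Prop :=
  type_of% @Summit.Langlands.Langlands.Cruxes.SectorComplementR.Birth.stub_pairLBoundaryJS

/-- The statement of `stub_pairLPoleJS` (literally its type). [folklore] -/
def stub_pairLPoleJS : Prop :=
  type_of% @Summit.Langlands.Langlands.Cruxes.SectorComplementR.Birth.stub_pairLPoleJS

end _Goal

/-! ## 3. The composition (kernel-checked, no sorry): R → JS (2.2) → JS (2.3) → the crux BY NAME -/

/-- **`SectorComplementR` from its three by-name leaves.**  Discard the sector hypothesis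
`UnrefinedWeightTwoLiftingR` (inert: one cell of R's clause (B)) and conclude `Langlands` from R and
JS (2.2)–(2.3) by the landed seam
`PhantomRMYoshidaJunctionOfR.langlands_of_reciprocityUpToIrreducibilityR_text_of_JS` (clause (B) is R's; the
avatar of clause (A) is R's, irreducible by the isobaric bootstrap, unique up to conjugacy by Flath +
Chebotarev–Brauer–Nesbitt).  Hypotheses = the three stub statements BY STUB NAME (`_Goal.stub_*`), in the order
R, (2.2), (2.3); conclusion = the route decl `Summit.Langlands.Langlands.Theses.RepeatedRootSocle.SectorComplementR`
by name.
[cite: BuzzardGeeLMS2014, Conj. 3.2.1 and Conj. 3.2.2] [cite: ArthurClozelAMS120, Ch. 3 §2 (2.2)–(2.3)] -/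
theorem SectorComplementR_of (h1 : _Goal.stub_reciprocityUpToIrreducibilityR) (h2 : _Goal.stub_pairLBoundaryJS)
    (h3 : _Goal.stub_pairLPoleJS) : Summit.Langlands.Langlands.Theses.RepeatedRootSocle.SectorComplementR := by
  dsimp only [_Goal.stub_reciprocityUpToIrreducibilityR, _Goal.stub_pairLBoundaryJS, _Goal.stub_pairLPoleJS]
    at h1 h2 h3
  rw [sectorComplementR_iff]
  intro _hX
  exact Summit.Langlands.Langlands.Theorems.PhantomRMYoshidaJunctionOfR.langlands_of_reciprocityUpToIrreducibilityR_text_of_JS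
    h2 h3 h1

/-- By-name sanity check (an `example`, not a declaration, so that exactly one theorem of this file concludes the
crux): the three stubs feed the composition as they stand. -/
example : Summit.Langlands.Langlands.Theses.RepeatedRootSocle.SectorComplementR :=
  SectorComplementR_of stub_reciprocityUpToIrreducibilityR stub_pairLBoundaryJS stub_pairLPoleJS

end Summit.Langlands.Langlands.Cruxes.SectorComplementR.Birth

end
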